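import Summits.CriticalPhenomena.PercolationContinuityZ3.Theorems.PercNearOneGluingNoHeavyLowerTailSunflowerSpectatorTransferOrPetalPair
import Summits.CriticalPhenomena.PercolationContinuityZ3.Theorems.PercNearOneGluingNoHeavyLowerTailSunflowerOrPetalUpsets
import HarnessLib

/-!
# `NoHeavyLowerTail` (crux stmt-CriticalPhenomena-4575), abstract sunflower cubic: (♣) behind a two-point disjunctive petal of ANY label, and the
# `ofUpsets` form

Support file (seat `prim-ineq-gen-2` gen 22; `--supports stmt-CriticalPhenomena-4575`).  No `sorry`, no new definitions.  Corollaries of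
`Sunflower.spectatorTransfer_three_of_isOrPetal_pair` (`…SunflowerSpectatorTransferOrPetalPair`) by the cyclic relabelling `rotate`
(`…SunflowerPrincipalPetal`): the spectator counts transport as `rotate.SA = SA`, `rotate.SB = SB`, `rotate.Nabk (rot5 k) = Nabk k`,
`rotate.Nkk (rot5 k) = Nkk k`.  Hence `2·Nabk ℓ ≤ SA + SB + 2·Nkk ℓ` behind a two-point disjunctive petal of label `ℓ ∈ {1,2,3}`, and for the
θ-pullback `ofUpsets U` of three up-sets one of which is `{S : S ∩ {s,t} ≠ ∅}`.
-/

namespace Summit.CriticalPhenomena.PercolationContinuityZ3.Theorems.SunflowerPartition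

open Finset

variable {α : Type*} [Fintype α] [DecidableEq α]

namespace Sunflower

/-- `kk` is invariant under the petal rotation. [this work] -/
theorem kk_rot5 : ∀ y z : Fin 5, kk (rot5 y) (rot5 z) = kk y z := by decide

/-- `rot5 v = 4 ↔ v = 4`. [this work] -/
theorem rot5_eq_four_iff : ∀ v : Fin 5, rot5 v = 4 ↔ v = 4 := by decide

/-- `rot5 v = 0 ↔ v = 0`. [this work] -/
theorem rot5_eq_zero_iff : ∀ v : Fin 5, rot5 v = 0 ↔ v = 0 := by decide

/-- `rot5` is injective. [this work] -/
theorem rot5_eq_rot5_iff : ∀ v w : Fin 5, rot5 v = rot5 w ↔ v = w := by decide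

variable (F : Sunflower α)

/-- `SA` is invariant under the petal rotation. [this work] -/
theorem rotate_SA : F.rotate.SA = F.SA := by
  unfold SA Sw
  refine sum_congr rfl fun q _ => ?_
  rw [F.lab_rotate, F.lab_rotate, F.lab_rotate, kk_rot5]
  simp only [rot5_eq_four_iff]

/-- `SB` is invariant under the petal rotation. [this work] -/
theorem rotate_SB : F.rotate.SB = F.SB := by
  unfold SB Sw
  refine sum_congr rfl fun q _ => ?_
  rw [F.lab_rotate, F.lab_rotate, F.lab_rotate, kk_rot5]
  simp only [rot5_eq_zero_iff]

/-- `Nabk` transports along the petal rotation. [this work] -/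
theorem rotate_Nabk (k : Fin 5) : F.rotate.Nabk (rot5 k) = F.Nabk k := by
  unfold Nabk
  refine sum_congr rfl fun q _ => ?_
  rw [F.lab_rotate, F.lab_rotate, F.lab_rotate]
  simp only [rot5_eq_four_iff, rot5_eq_zero_iff, rot5_eq_rot5_iff]

/-- `Nkk` transports along the petal rotation. [this work] -/
theorem rotate_Nkk (k : Fin 5) : F.rotate.Nkk (rot5 k) = F.Nkk k := by
  unfold Nkk
  refine sum_congr rfl fun q _ => ?_
  rw [F.lab_rotate, F.lab_rotate]
  simp only [rot5_eq_rot5_iff]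

/-- **(♣) behind a two-point disjunctive petal of any label `ℓ ∈ {1,2,3}`**: if the petal-`ℓ` sets are exactly the non-kernel sets meeting `{s,t}`
(`s ≠ t`), then `2·Nabk ℓ ≤ SA + SB + 2·Nkk ℓ`. [this work] -/
theorem spectatorTransfer_of_orPetal_label_pair (ℓ : Fin 5) (hℓ : ℓ = 1 ∨ ℓ = 2 ∨ ℓ = 3) {s t : α} (hst : s ≠ t)
    (h1 : ∀ S : Finset α, (S ∩ {s, t}).Nonempty → F.lab S = ℓ ∨ F.lab S = 4) (h2 : ∀ S : Finset α, F.lab S = ℓ → (S ∩ {s, t}).Nonempty) :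
    2 * F.Nabk ℓ ≤ F.SA + F.SB + 2 * F.Nkk ℓ := by
  rcases hℓ with rfl | rfl | rfl
  · -- label `1`: rotate once (`rot5 1 = 3`)
    have e3 : rot5 1 = 3 := by decide
    rw [← F.rotate_SA, ← F.rotate_SB, ← F.rotate_Nabk 1, ← F.rotate_Nkk 1, e3]
    refine F.rotate.spectatorTransfer_three_of_isOrPetal_pair hst ⟨⟨s, mem_insert_self _ _⟩, fun S hS => ?_, fun S hS => h2 S ?_⟩
    · rw [F.lab_rotate]
      rcases h1 S hS with e | e <;> rw [e] <;> decide
    · rw [F.lab_rotate] at hS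
      revert hS; generalize F.lab S = x; revert x; decide
  · -- label `2`: rotate twice
    have e3 : rot5 (rot5 2) = 3 := by decide
    rw [← F.rotate_SA, ← F.rotate_SB, ← F.rotate_Nabk 2, ← F.rotate_Nkk 2, ← F.rotate.rotate_SA, ← F.rotate.rotate_SB,
      ← F.rotate.rotate_Nabk (rot5 2), ← F.rotate.rotate_Nkk (rot5 2), e3]
    refine F.rotate.rotate.spectatorTransfer_three_of_isOrPetal_pair hst ⟨⟨s, mem_insert_self _ _⟩, fun S hS => ?_, fun S hS => h2 S ?_⟩
    · rw [F.rotate.lab_rotate, F.lab_rotate]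
      rcases h1 S hS with e | e <;> rw [e] <;> decide
    · rw [F.rotate.lab_rotate, F.lab_rotate] at hS
      revert hS; generalize F.lab S = x; revert x; decide
  · exact F.spectatorTransfer_three_of_isOrPetal_pair hst ⟨⟨s, mem_insert_self _ _⟩, h1, h2⟩

end Sunflower

/-- **(♣) for `θ(U₀,U₁,U₂)` with `U_i = {S : S ∩ {s,t} ≠ ∅}`** (`s ≠ t`), for the petal of that index: `2·Nabk ≤ SA + SB + 2·Nkk`. [this work] -/
theorem spectatorTransfer_ofUpsets_or_pair (U : Fin 3 → Finset (Finset α)) (hU : ∀ i, IsUpperSet (U i : Set (Finset α))) (i : Fin 3)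
    {s t : α} (hst : s ≠ t) (hUi : ∀ S : Finset α, S ∈ U i ↔ (S ∩ {s, t}).Nonempty) :
    2 * (ofUpsets U hU).Nabk ⟨i.val + 1, by omega⟩ ≤ (ofUpsets U hU).SA + (ofUpsets U hU).SB + 2 * (ofUpsets U hU).Nkk ⟨i.val + 1, by omega⟩ := by
  set F := ofUpsets U hU with hF
  have hV : ∀ S : Finset α, (S ∩ {s, t}).Nonempty → S ∈ F.V i := fun S hS => by
    show S ∈ U i ∪ twoOf U
    exact mem_union_left _ ((hUi S).2 hS)
  have hback : ∀ S : Finset α, S ∈ F.V i → S ∉ F.A → (S ∩ {s, t}).Nonempty := fun S hS hA =>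
    (hUi S).1 (mem_U_of_mem_ofUpsets_V hU hS hA)
  fin_cases i
  · refine F.spectatorTransfer_of_orPetal_label_pair 1 (Or.inl rfl) hst (fun S hS => (F.lab_V0_iff S).2 (hV S hS)) fun S hS => ?_
    have hSV : S ∈ F.V 0 := (F.lab_V0_iff S).1 (Or.inl hS)
    exact hback S hSV fun hA => by have := (F.lab_eq_four_iff S).2 hA; omega
  · refine F.spectatorTransfer_of_orPetal_label_pair 2 (Or.inr (Or.inl rfl)) hst (fun S hS => (F.lab_V1_iff S).2 (hV S hS)) fun S hS => ?_
    have hSV : S ∈ F.V 1 := (F.lab_V1_iff S).1 (Or.inl hS)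
    exact hback S hSV fun hA => by have := (F.lab_eq_four_iff S).2 hA; omega
  · refine F.spectatorTransfer_of_orPetal_label_pair 3 (Or.inr (Or.inr rfl)) hst (fun S hS => (F.lab_V2_iff S).2 (hV S hS)) fun S hS => ?_
    have hSV : S ∈ F.V 2 := (F.lab_V2_iff S).1 (Or.inl hS)
    exact hback S hSV fun hA => by have := (F.lab_eq_four_iff S).2 hA; omega

end Summit.CriticalPhenomena.PercolationContinuityZ3.Theorems.SunflowerPartition
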